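import Literature.NumberTheory.LFunctions.QuadraticResiduePrimesMertens
import HarnessLib

/-!
# Lenstra–Pomerance 1992, Theorem 9.1: choosing the multiplier

H. W. Lenstra Jr., C. Pomerance, *A rigorous time bound for factoring integers*, J. Amer. Math.
Soc. **5** (1992), §9 (pp. 504–506). For an odd positive integer `n` let
`𝒟 = {3, 4, 7, 8}` if `n ≡ 1 (mod 4)` and `𝒟 = {1, 5, 8, 12}` if `n ≡ 3 (mod 4)` (the multipliers of
Step 1 of Algorithm 10.1). Then `Δ = −dn` is a negative discriminant for every `d ∈ 𝒟`, and
**Theorem 9.1** asserts that some `d ∈ 𝒟` makes `Δ` satisfy the three density conditions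
(9.3) `π(z; 𝒫_Δ) ≥ z/(6 log z)`, (9.4) `π(w; 𝒫_Δ) ≥ w/(6 log w)`, (9.5)
`S(v, y; 𝒫_Δ) ≥ (1/6)·(½-window length)` on which Theorems 4.1 and 8.1 (hence 10.3) depend, where
`𝒫_Δ = {p : (Δ/p) = 1}` is the set of primes split in the order of discriminant `Δ` — here the odd
primes `p ∤ Δ` with two square roots of `Δ` modulo `p`, `ω_Δ(p) = 2` in the notation of
`QuadraticResiduePrimes.lean` (this differs from the paper's Kronecker-symbol set at most in the
prime `2`).

`exists_multiplier` proves it in the following explicit form (constants `X₀, K` absolute, i.e.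
depending only on the twelve products `d₁d₂`): for `n` odd and reals `z, w ≥ X₀`, `2 ≤ v ≤ y`
with `ω(n) ≤ z/(12 log z)`, `ω(n) ≤ w/(12 log w)`, `K/log v ≤ ℓ/12`, `ω(n)/v ≤ ℓ/12`
(`ω(n) = #primeFactors n`, `ℓ = log log y − log log v`), some `d ∈ 𝒟` gives `Δ = −dn < 0`,
`Δ ≡ 0, 1 (mod 4)`, `π(z; 𝒫_Δ) ≥ z/(6 log z)`, `π(w; 𝒫_Δ) ≥ w/(6 log w)` and `S(v, y; 𝒫_Δ) ≥ ℓ/6`.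
(In the paper these largeness hypotheses are (9.2); `#𝒩 = O(log n/log log n)` there is replaced
by the explicit `ω(n)`-hypotheses, and the window length `ℓ` plays the role of `1/log u`.)

The proof is the paper's: for `d₁ ≠ d₂` in `𝒟` the product `D = d₁d₂` is not a square, every
prime `p ∤ n` with `(D/p) = −1` has `(Δ₁/p)(Δ₂/p) = (D n²/p) = −1` and so lies in
`𝒫_{Δ₁} ∪ 𝒫_{Δ₂}` (`omega_eq_two_or_of_omega_mul_eq_zero`); since the primes with `(D/p) = −1`
have density `1/2` with a rate (`card_nonresidue_ge_of_lt_half`, `abs_sum_Ioc_nonresidue_inv_sub_le`,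
from the prime ideal theorem for `ℚ(√D)`), each of the three conditions fails for at most one
`d ∈ 𝒟`, and `#𝒟 = 4 > 3`. Everything is proved; no named facts.

## References

* H. W. Lenstra Jr., C. Pomerance, J. Amer. Math. Soc. 5 (1992) 483–516, §9, Theorem 9.1 and
  its proof; §10, Algorithm 10.1 Step 1. [LenstraPomerance1992]
-/

noncomputable section

open Finset Polynomial
open Literature.NumberTheory.Sieve Literature.NumberTheory.LFunctions

namespace Literature.Computability.QuantumComplexity

namespace LenstraPomerance1992

/-! ### Non-squares -/

/-- `m² < D < (m+1)²` forces `D` not to be a square. [folklore] -/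
theorem not_isSquare_of_sq_lt_lt {D : ℤ} (m : ℕ) (h1 : (m : ℤ) ^ 2 < D) (h2 : D < ((m : ℤ) + 1) ^ 2) :
    ¬ IsSquare D := by
  rintro ⟨r, hr⟩
  have hk : ((r.natAbs : ℕ) : ℤ) ^ 2 = D := by rw [Int.natAbs_sq, hr, sq]
  have hk0 : (0 : ℤ) ≤ (r.natAbs : ℕ) := Int.natCast_nonneg _
  rcases le_or_gt r.natAbs m with h | h
  · have h' : ((r.natAbs : ℕ) : ℤ) ≤ m := by exact_mod_cast h
    nlinarith
  · have h' : (m : ℤ) + 1 ≤ ((r.natAbs : ℕ) : ℤ) := by exact_mod_cast h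
    nlinarith

/-- The products `d₁ d₂` of two distinct multipliers (`d₁, d₂ ∈ {3,4,7,8}` or `∈ {1,5,8,12}`):
`{5, 8, 12, 21, 24, 28, 32, 40, 56, 60, 96}`; none is a square.
[cite: LenstraPomerance1992, §9 proof of Thm 9.1] -/
theorem not_isSquare_of_mem_products {D : ℤ}
    (hD : D ∈ ({5, 8, 12, 21, 24, 28, 32, 40, 56, 60, 96} : Finset ℤ)) : ¬ IsSquare D := by
  simp only [mem_insert, mem_singleton] at hD
  rcases hD with rfl | rfl | rfl | rfl | rfl | rfl | rfl | rfl | rfl | rfl | rfl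
  · exact not_isSquare_of_sq_lt_lt 2 (by norm_num) (by norm_num)
  · exact not_isSquare_of_sq_lt_lt 2 (by norm_num) (by norm_num)
  · exact not_isSquare_of_sq_lt_lt 3 (by norm_num) (by norm_num)
  · exact not_isSquare_of_sq_lt_lt 4 (by norm_num) (by norm_num)
  · exact not_isSquare_of_sq_lt_lt 4 (by norm_num) (by norm_num)
  · exact not_isSquare_of_sq_lt_lt 5 (by norm_num) (by norm_num)
  · exact not_isSquare_of_sq_lt_lt 5 (by norm_num) (by norm_num)
  · exact not_isSquare_of_sq_lt_lt 6 (by norm_num) (by norm_num)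
  · exact not_isSquare_of_sq_lt_lt 7 (by norm_num) (by norm_num)
  · exact not_isSquare_of_sq_lt_lt 7 (by norm_num) (by norm_num)
  · exact not_isSquare_of_sq_lt_lt 9 (by norm_num) (by norm_num)

/-- For distinct `d₁, d₂` in the multiplier set of `n`, `d₁ d₂` is one of the eleven products.
[cite: LenstraPomerance1992, §9 proof of Thm 9.1] -/
theorem mul_mem_products {n d₁ d₂ : ℕ}
    (h₁ : d₁ ∈ (if n % 4 = 1 then ({3, 4, 7, 8} : Finset ℕ) else {1, 5, 8, 12}))
    (h₂ : d₂ ∈ (if n % 4 = 1 then ({3, 4, 7, 8} : Finset ℕ) else {1, 5, 8, 12})) (hne : d₁ ≠ d₂) :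
    ((d₁ * d₂ : ℕ) : ℤ) ∈ ({5, 8, 12, 21, 24, 28, 32, 40, 56, 60, 96} : Finset ℤ) := by
  split_ifs at h₁ h₂ with h
  · simp only [mem_insert, mem_singleton] at h₁ h₂
    rcases h₁ with rfl | rfl | rfl | rfl <;> rcases h₂ with rfl | rfl | rfl | rfl <;>
      first | exact absurd rfl hne | decide
  · simp only [mem_insert, mem_singleton] at h₁ h₂
    rcases h₁ with rfl | rfl | rfl | rfl <;> rcases h₂ with rfl | rfl | rfl | rfl <;>
      first | exact absurd rfl hne | decide

/-- The multiplier set has four elements. [cite: LenstraPomerance1992, §10 Algorithm 10.1 Step 1] -/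
theorem card_multiplierSet (n : ℕ) :
    #(if n % 4 = 1 then ({3, 4, 7, 8} : Finset ℕ) else {1, 5, 8, 12}) = 4 := by
  split_ifs <;> decide

/-- `Δ = −dn` is a negative discriminant: `Δ < 0` and `Δ ≡ 0` or `1 (mod 4)`, for `n` odd and
`d` in its multiplier set. [cite: LenstraPomerance1992, §9 Thm 9.1] -/
theorem neg_mul_isNegDiscriminant {n d : ℕ} (hn : Odd n)
    (hd : d ∈ (if n % 4 = 1 then ({3, 4, 7, 8} : Finset ℕ) else {1, 5, 8, 12})) :
    (-((d * n : ℕ) : ℤ)) < 0 ∧ ((-((d * n : ℕ) : ℤ)) % 4 = 0 ∨ (-((d * n : ℕ) : ℤ)) % 4 = 1) := by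
  obtain ⟨k, rfl⟩ := hn
  split_ifs at hd with h
  · simp only [mem_insert, mem_singleton] at hd
    rcases hd with rfl | rfl | rfl | rfl <;> push_cast <;> omega
  · simp only [mem_insert, mem_singleton] at hd
    rcases hd with rfl | rfl | rfl | rfl <;> push_cast <;> omega

/-! ### The key inclusion `{p ∤ n : (d₁d₂/p) = −1} ⊆ 𝒫_{−d₁n} ∪ 𝒫_{−d₂n}` -/

/-- If `p ∤ n` is a prime with no square root of `d₁ d₂` (so `p` odd, `p ∤ d₁d₂`,
`(d₁d₂/p) = −1`), then `(−d₁n/p)(−d₂n/p) = (d₁d₂n²/p) = −1`, so one of `−d₁n`, `−d₂n` has two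
square roots modulo `p`. [cite: LenstraPomerance1992, §9 proof of Thm 9.1] -/
theorem omega_eq_two_or_of_omega_mul_eq_zero {n d₁ d₂ p : ℕ} (hp : p.Prime) (hpn : ¬ p ∣ n)
    (h0 : polyRootCountMod ![X ^ 2 - C ((d₁ * d₂ : ℕ) : ℤ)] p = 0) :
    polyRootCountMod ![X ^ 2 - C (-((d₁ * n : ℕ) : ℤ))] p = 2 ∨
      polyRootCountMod ![X ^ 2 - C (-((d₂ * n : ℕ) : ℤ))] p = 2 := by
  haveI := Fact.mk hp
  set D : ℤ := ((d₁ * d₂ : ℕ) : ℤ) with hDdef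
  have hp2 : p ≠ 2 := by
    rintro rfl
    rw [QuadraticResiduePrimes.omega_two] at h0
    exact one_ne_zero h0
  have hpD : ¬ (p : ℤ) ∣ D := fun h => by
    rw [QuadraticResiduePrimes.omega_of_dvd D hp h] at h0
    exact one_ne_zero h0
  have hleg : legendreSym p D = -1 := by
    have h := QuadraticResiduePrimes.omega_eq_one_add_legendreSym D hp2
    rw [h0] at h
    push_cast at h
    linarith
  -- `p ∤ d₁`, `p ∤ d₂`, hence `(Δᵢ : ZMod p) ≠ 0`
  have hnz : ∀ {d : ℕ}, ¬ (p : ℤ) ∣ (d : ℤ) → ((-((d * n : ℕ) : ℤ) : ℤ) : ZMod p) ≠ 0 := by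
    intro d hd h
    rw [ZMod.intCast_zmod_eq_zero_iff_dvd, dvd_neg] at h
    push_cast at h
    rcases (Int.Prime.dvd_mul' hp h) with h1 | h1
    · exact hd h1
    · exact hpn (Int.natCast_dvd_natCast.1 h1)
  have hd₁ : ¬ (p : ℤ) ∣ (d₁ : ℤ) := fun h => hpD (by rw [hDdef]; push_cast; exact h.mul_right _)
  have hd₂ : ¬ (p : ℤ) ∣ (d₂ : ℤ) := fun h => hpD (by rw [hDdef]; push_cast; exact h.mul_left _)
  have hn0 : ((n : ℤ) : ZMod p) ≠ 0 := by
    intro h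
    rw [ZMod.intCast_zmod_eq_zero_iff_dvd, Int.natCast_dvd_natCast] at h
    exact hpn h
  have hprod : legendreSym p (-((d₁ * n : ℕ) : ℤ)) * legendreSym p (-((d₂ * n : ℕ) : ℤ)) = -1 := by
    rw [← legendreSym.mul, show (-((d₁ * n : ℕ) : ℤ)) * (-((d₂ * n : ℕ) : ℤ)) = D * (n : ℤ) ^ 2 by
      rw [hDdef]; push_cast; ring, legendreSym.mul, legendreSym.sq_one' p hn0, hleg]
    ring
  have htwo : ∀ {d : ℕ}, legendreSym p (-((d * n : ℕ) : ℤ)) = 1 →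
      polyRootCountMod ![X ^ 2 - C (-((d * n : ℕ) : ℤ))] p = 2 := by
    intro d h1
    have h := QuadraticResiduePrimes.omega_eq_one_add_legendreSym (-((d * n : ℕ) : ℤ)) hp2
    rw [h1] at h
    exact_mod_cast h
  rcases legendreSym.eq_one_or_neg_one p (hnz hd₁) with h1 | h1
  · exact Or.inl (htwo h1)
  · rw [h1] at hprod
    have h2 : legendreSym p (-((d₂ * n : ℕ) : ℤ)) = 1 := by linarith
    exact Or.inr (htwo h2)

/-- Counting form: over any finite set `P` of primes,
`#{p ∈ P : ω_{d₁d₂}(p) = 0} ≤ #{p ∈ P : ω_{−d₁n}(p) = 2} + #{p ∈ P : ω_{−d₂n}(p) = 2} + ω(n)`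
(`n ≠ 0`). [cite: LenstraPomerance1992, §9 proof of Thm 9.1] -/
theorem card_filter_omega_mul_le {n d₁ d₂ : ℕ} (hn : n ≠ 0) {P : Finset ℕ}
    (hP : ∀ p ∈ P, p.Prime) :
    #(P.filter fun p => polyRootCountMod ![X ^ 2 - C ((d₁ * d₂ : ℕ) : ℤ)] p = 0) ≤
      #(P.filter fun p => polyRootCountMod ![X ^ 2 - C (-((d₁ * n : ℕ) : ℤ))] p = 2) +
        #(P.filter fun p => polyRootCountMod ![X ^ 2 - C (-((d₂ * n : ℕ) : ℤ))] p = 2) +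
          n.primeFactors.card := by
  have hsub : (P.filter fun p => polyRootCountMod ![X ^ 2 - C ((d₁ * d₂ : ℕ) : ℤ)] p = 0) ⊆
      (P.filter fun p => polyRootCountMod ![X ^ 2 - C (-((d₁ * n : ℕ) : ℤ))] p = 2) ∪
        (P.filter fun p => polyRootCountMod ![X ^ 2 - C (-((d₂ * n : ℕ) : ℤ))] p = 2) ∪
          n.primeFactors := by
    intro p hp
    obtain ⟨hpP, h0⟩ := mem_filter.1 hp
    have hpr := hP p hpP
    by_cases hpn : p ∣ n
    · exact mem_union_right _ (Nat.mem_primeFactors.2 ⟨hpr, hpn, hn⟩)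
    · rcases omega_eq_two_or_of_omega_mul_eq_zero hpr hpn h0 with h | h
      · exact mem_union_left _ (mem_union_left _ (mem_filter.2 ⟨hpP, h⟩))
      · exact mem_union_left _ (mem_union_right _ (mem_filter.2 ⟨hpP, h⟩))
  exact (card_le_card hsub).trans ((card_union_le _ _).trans
    (Nat.add_le_add_right (card_union_le _ _) _))

/-- Sums over a subset of a triple union of a nonnegative function. [folklore] -/
theorem sum_le_of_subset_union₃ {s a b c : Finset ℕ} {f : ℕ → ℝ} (hf : ∀ i, 0 ≤ f i)
    (h : s ⊆ a ∪ b ∪ c) : ∑ i ∈ s, f i ≤ ∑ i ∈ a, f i + ∑ i ∈ b, f i + ∑ i ∈ c, f i := by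
  have hu : ∀ s t : Finset ℕ, ∑ i ∈ s ∪ t, f i ≤ ∑ i ∈ s, f i + ∑ i ∈ t, f i := by
    intro s t
    have := sum_union_inter (s₁ := s) (s₂ := t) (f := f)
    have h0 : 0 ≤ ∑ i ∈ s ∩ t, f i := sum_nonneg fun i _ => hf i
    linarith
  calc ∑ i ∈ s, f i ≤ ∑ i ∈ a ∪ b ∪ c, f i := sum_le_sum_of_subset_of_nonneg h fun i _ _ => hf i
    _ ≤ ∑ i ∈ a ∪ b, f i + ∑ i ∈ c, f i := hu _ _
    _ ≤ ∑ i ∈ a, f i + ∑ i ∈ b, f i + ∑ i ∈ c, f i := by linarith [hu a b]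

/-- Weighted form over the window `(v, y]`:
`S_{d₁d₂}⁻(v, y) ≤ S(v, y; 𝒫_{−d₁n}) + S(v, y; 𝒫_{−d₂n}) + ω(n)/v`.
[cite: LenstraPomerance1992, §9 proof of Thm 9.1] -/
theorem sum_filter_omega_mul_le {n d₁ d₂ : ℕ} (hn : n ≠ 0) {v y : ℝ} (hv : 0 < v) :
    ∑ p ∈ (Ioc ⌊v⌋₊ ⌊y⌋₊).filter
        (fun p => p.Prime ∧ polyRootCountMod ![X ^ 2 - C ((d₁ * d₂ : ℕ) : ℤ)] p = 0), (1 : ℝ) / p ≤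
      ∑ p ∈ (Ioc ⌊v⌋₊ ⌊y⌋₊).filter
          (fun p => p.Prime ∧ polyRootCountMod ![X ^ 2 - C (-((d₁ * n : ℕ) : ℤ))] p = 2), (1 : ℝ) / p +
        ∑ p ∈ (Ioc ⌊v⌋₊ ⌊y⌋₊).filter
          (fun p => p.Prime ∧ polyRootCountMod ![X ^ 2 - C (-((d₂ * n : ℕ) : ℤ))] p = 2), (1 : ℝ) / p +
        n.primeFactors.card / v := by
  set W := Ioc ⌊v⌋₊ ⌊y⌋₊ with hW
  have hsub : (W.filter fun p => p.Prime ∧ polyRootCountMod ![X ^ 2 - C ((d₁ * d₂ : ℕ) : ℤ)] p = 0) ⊆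
      (W.filter fun p => p.Prime ∧ polyRootCountMod ![X ^ 2 - C (-((d₁ * n : ℕ) : ℤ))] p = 2) ∪
        (W.filter fun p => p.Prime ∧ polyRootCountMod ![X ^ 2 - C (-((d₂ * n : ℕ) : ℤ))] p = 2) ∪
          (W.filter fun p => p.Prime ∧ p ∣ n) := by
    intro p hp
    obtain ⟨hpW, hpr, h0⟩ := mem_filter.1 hp
    by_cases hpn : p ∣ n
    · exact mem_union_right _ (mem_filter.2 ⟨hpW, hpr, hpn⟩)
    · rcases omega_eq_two_or_of_omega_mul_eq_zero hpr hpn h0 with h | h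
      · exact mem_union_left _ (mem_union_left _ (mem_filter.2 ⟨hpW, hpr, h⟩))
      · exact mem_union_left _ (mem_union_right _ (mem_filter.2 ⟨hpW, hpr, h⟩))
  refine (sum_le_of_subset_union₃ (fun i => by positivity) hsub).trans ?_
  suffices hlast : ∑ p ∈ W.filter (fun p => p.Prime ∧ p ∣ n), (1 : ℝ) / p ≤ n.primeFactors.card / v by
    linarith
  -- the primes of the window dividing `n`: at most `ω(n)` terms, each `≤ 1/v`
  have hcard : #(W.filter fun p => p.Prime ∧ p ∣ n) ≤ n.primeFactors.card :=
    card_le_card fun p hp => by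
      obtain ⟨-, hpr, hpn⟩ := mem_filter.1 hp
      exact Nat.mem_primeFactors.2 ⟨hpr, hpn, hn⟩
  have hterm : ∀ p ∈ W.filter (fun p => p.Prime ∧ p ∣ n), (1 : ℝ) / p ≤ 1 / v := by
    intro p hp
    have hpW := (mem_Ioc.1 (mem_filter.1 hp).1).1
    have hvp : v < p := by
      have := Nat.lt_floor_add_one v
      have h' : ((⌊v⌋₊ + 1 : ℕ) : ℝ) ≤ p := by exact_mod_cast hpW
      push_cast at h'
      linarith
    exact one_div_le_one_div_of_le hv hvp.le
  calc ∑ p ∈ W.filter (fun p => p.Prime ∧ p ∣ n), (1 : ℝ) / p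
      ≤ #(W.filter fun p => p.Prime ∧ p ∣ n) • (1 / v) := sum_le_card_nsmul _ _ _ hterm
    _ ≤ n.primeFactors.card / v := by
        rw [nsmul_eq_mul, mul_one_div]
        exact div_le_div_of_nonneg_right (by exact_mod_cast hcard) hv.le

/-! ### Pigeonhole over the four multipliers -/

/-- If each of three properties fails for at most one element of a four-element set, some element
has all three. [folklore] -/
theorem exists_good_of_pairwise {α : Type*} [DecidableEq α] {𝒟 : Finset α} (h𝒟 : #𝒟 = 4)
    (G₁ G₂ G₃ : α → Prop) (h₁ : ∀ a ∈ 𝒟, ∀ b ∈ 𝒟, a ≠ b → G₁ a ∨ G₁ b)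
    (h₂ : ∀ a ∈ 𝒟, ∀ b ∈ 𝒟, a ≠ b → G₂ a ∨ G₂ b) (h₃ : ∀ a ∈ 𝒟, ∀ b ∈ 𝒟, a ≠ b → G₃ a ∨ G₃ b) :
    ∃ d ∈ 𝒟, G₁ d ∧ G₂ d ∧ G₃ d := by
  classical
  set B₁ := 𝒟.filter fun a => ¬ G₁ a with hB₁
  set B₂ := 𝒟.filter fun a => ¬ G₂ a with hB₂
  set B₃ := 𝒟.filter fun a => ¬ G₃ a with hB₃
  have hc : ∀ {G : α → Prop}, (∀ a ∈ 𝒟, ∀ b ∈ 𝒟, a ≠ b → G a ∨ G b) →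
      #(𝒟.filter fun a => ¬ G a) ≤ 1 := by
    intro G hG
    refine Finset.card_le_one.2 fun a ha b hb => ?_
    obtain ⟨ha𝒟, hGa⟩ := mem_filter.1 ha
    obtain ⟨hb𝒟, hGb⟩ := mem_filter.1 hb
    by_contra hab
    rcases hG a ha𝒟 b hb𝒟 hab with h | h
    · exact hGa h
    · exact hGb h
  have hU : #(B₁ ∪ B₂ ∪ B₃) ≤ 3 :=
    (card_union_le _ _).trans (by
      have := Nat.add_le_add (Nat.add_le_add (hc h₁) (hc h₂)) (hc h₃)
      exact (Nat.add_le_add_right (card_union_le _ _) _).trans this)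
  have hpos : 0 < #(𝒟 \ (B₁ ∪ B₂ ∪ B₃)) := by
    have := le_card_sdiff (B₁ ∪ B₂ ∪ B₃) 𝒟
    omega
  obtain ⟨d, hd⟩ := card_pos.1 hpos
  rw [mem_sdiff] at hd
  refine ⟨d, hd.1, ?_, ?_, ?_⟩
  · by_contra h; exact hd.2 (mem_union_left _ (mem_union_left _ (mem_filter.2 ⟨hd.1, h⟩)))
  · by_contra h; exact hd.2 (mem_union_left _ (mem_union_right _ (mem_filter.2 ⟨hd.1, h⟩)))
  · by_contra h; exact hd.2 (mem_union_right _ (mem_filter.2 ⟨hd.1, h⟩))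

/-! ### The absolute constants -/

/-- The two absolute constants of Theorem 9.1: `X₀` beyond which `#{p ≤ x : (D/p) = −1} ≥
(5/12) x/log x`, and `K` with `|S_D⁻(v, y) − ℓ/2| ≤ K/log v` (`ℓ = log log y − log log v`), for all
eleven products `D = d₁d₂`. [cite: LenstraPomerance1992, §9 proof of Thm 9.1] -/
theorem exists_constants :
    ∃ X₀ K : ℝ, 2 ≤ X₀ ∧ 0 ≤ K ∧
      ∀ D ∈ ({5, 8, 12, 21, 24, 28, 32, 40, 56, 60, 96} : Finset ℤ),
        (∀ x : ℝ, X₀ ≤ x → 5 / 12 * x / Real.log x ≤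
          #((Nat.primesLE ⌊x⌋₊).filter fun p => polyRootCountMod ![X ^ 2 - C D] p = 0)) ∧
        (∀ v y : ℝ, 2 ≤ v → v ≤ y →
          |∑ p ∈ (Ioc ⌊v⌋₊ ⌊y⌋₊).filter
                (fun p => p.Prime ∧ polyRootCountMod ![X ^ 2 - C D] p = 0), (1 : ℝ) / p -
              1 / 2 * (Real.log (Real.log y) - Real.log (Real.log v))| ≤ K / Real.log v) := by
  set S : Finset ℤ := {5, 8, 12, 21, 24, 28, 32, 40, 56, 60, 96} with hS
  have h1 : ∀ D : ℤ, ∃ x₀ : ℝ, D ∈ S → ∀ x : ℝ, x₀ ≤ x → 5 / 12 * x / Real.log x ≤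
      #((Nat.primesLE ⌊x⌋₊).filter fun p => polyRootCountMod ![X ^ 2 - C D] p = 0) := by
    intro D
    by_cases hD : D ∈ S
    · obtain ⟨x₀, h⟩ := QuadraticResiduePrimes.card_nonresidue_ge_of_lt_half D
        (not_isSquare_of_mem_products hD) (show (5 / 12 : ℝ) < 1 / 2 by norm_num)
      exact ⟨x₀, fun _ => h⟩
    · exact ⟨0, fun h => absurd h hD⟩
  choose x₀ hx₀ using h1
  have h2 : ∀ D : ℤ, ∃ K : ℝ, D ∈ S → ∀ v y : ℝ, 2 ≤ v → v ≤ y →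
      |∑ p ∈ (Ioc ⌊v⌋₊ ⌊y⌋₊).filter
            (fun p => p.Prime ∧ polyRootCountMod ![X ^ 2 - C D] p = 0), (1 : ℝ) / p -
          1 / 2 * (Real.log (Real.log y) - Real.log (Real.log v))| ≤ K / Real.log v := by
    intro D
    by_cases hD : D ∈ S
    · obtain ⟨K, h⟩ := QuadraticResiduePrimes.abs_sum_Ioc_nonresidue_inv_sub_le D
        (not_isSquare_of_mem_products hD) 0
      refine ⟨K, fun _ v y hv hvy => ?_⟩
      have := h v y hv hvy
      rwa [zero_add, pow_one] at this
    · exact ⟨0, fun h => absurd h hD⟩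
  choose K₀ hK₀ using h2
  refine ⟨2 + ∑ D ∈ S, |x₀ D|, ∑ D ∈ S, |K₀ D|, ?_, sum_nonneg fun D _ => abs_nonneg _,
    fun D hD => ⟨fun x hx => ?_, fun v y hv hvy => ?_⟩⟩
  · have : 0 ≤ ∑ D ∈ S, |x₀ D| := sum_nonneg fun D _ => abs_nonneg _
    linarith
  · refine hx₀ D hD x (le_trans ?_ hx)
    have h := single_le_sum (f := fun D => |x₀ D|) (fun D _ => abs_nonneg _) hD
    have h' := le_abs_self (x₀ D)
    linarith
  · refine (hK₀ D hD v y hv hvy).trans ?_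
    have hlv : 0 < Real.log v := Real.log_pos (by linarith)
    apply div_le_div_of_nonneg_right _ hlv.le
    have h := single_le_sum (f := fun D => |K₀ D|) (fun D _ => abs_nonneg _) hD
    exact (le_abs_self _).trans h

/-! ### Each condition fails for at most one multiplier -/

/-- (9.3)/(9.4): for `x ≥ X₀` with `ω(n) ≤ x/(12 log x)` and distinct `d₁, d₂` in the multiplier
set, `π(x; 𝒫_{−d₁n}) ≥ x/(6 log x)` or `π(x; 𝒫_{−d₂n}) ≥ x/(6 log x)`.
[cite: LenstraPomerance1992, §9 proof of Thm 9.1] -/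
theorem count_or_count {X₀ : ℝ} {n d₁ d₂ : ℕ} (hn : n ≠ 0) {x : ℝ}
    (hB : 5 / 12 * x / Real.log x ≤
      #((Nat.primesLE ⌊x⌋₊).filter fun p => polyRootCountMod ![X ^ 2 - C ((d₁ * d₂ : ℕ) : ℤ)] p = 0))
    (hX : X₀ ≤ x) (hω : (n.primeFactors.card : ℝ) ≤ x / (12 * Real.log x)) :
    x / (6 * Real.log x) ≤
        #((Nat.primesLE ⌊x⌋₊).filter fun p => polyRootCountMod ![X ^ 2 - C (-((d₁ * n : ℕ) : ℤ))] p = 2) ∨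
      x / (6 * Real.log x) ≤
        #((Nat.primesLE ⌊x⌋₊).filter fun p => polyRootCountMod ![X ^ 2 - C (-((d₂ * n : ℕ) : ℤ))] p = 2) := by
  by_contra h
  rw [not_or, not_le, not_le] at h
  have hle := card_filter_omega_mul_le (d₁ := d₁) (d₂ := d₂) hn (P := Nat.primesLE ⌊x⌋₊)
    fun p hp => Nat.prime_of_mem_primesLE hp
  have hle' : (#((Nat.primesLE ⌊x⌋₊).filter fun p =>
      polyRootCountMod ![X ^ 2 - C ((d₁ * d₂ : ℕ) : ℤ)] p = 0) : ℝ) ≤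
      #((Nat.primesLE ⌊x⌋₊).filter fun p => polyRootCountMod ![X ^ 2 - C (-((d₁ * n : ℕ) : ℤ))] p = 2) +
        #((Nat.primesLE ⌊x⌋₊).filter fun p => polyRootCountMod ![X ^ 2 - C (-((d₂ * n : ℕ) : ℤ))] p = 2) +
          (n.primeFactors.card : ℝ) := by exact_mod_cast hle
  have e : 5 / 12 * x / Real.log x = x / (6 * Real.log x) + x / (6 * Real.log x) + x / (12 * Real.log x) := by
    ring
  have _ := hX
  linarith

/-- (9.5): for `2 ≤ v ≤ y` with `K/log v ≤ ℓ/12`, `ω(n)/v ≤ ℓ/12` (`ℓ = log log y − log log v`)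
and distinct `d₁, d₂`, `S(v, y; 𝒫_{−d₁n}) ≥ ℓ/6` or `S(v, y; 𝒫_{−d₂n}) ≥ ℓ/6`.
[cite: LenstraPomerance1992, §9 proof of Thm 9.1] -/
theorem sum_or_sum {K : ℝ} {n d₁ d₂ : ℕ} (hn : n ≠ 0) {v y : ℝ} (hv : 2 ≤ v)
    (hB : |∑ p ∈ (Ioc ⌊v⌋₊ ⌊y⌋₊).filter
          (fun p => p.Prime ∧ polyRootCountMod ![X ^ 2 - C ((d₁ * d₂ : ℕ) : ℤ)] p = 0), (1 : ℝ) / p -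
        1 / 2 * (Real.log (Real.log y) - Real.log (Real.log v))| ≤ K / Real.log v)
    (hK : K / Real.log v ≤ (Real.log (Real.log y) - Real.log (Real.log v)) / 12)
    (hω : (n.primeFactors.card : ℝ) / v ≤ (Real.log (Real.log y) - Real.log (Real.log v)) / 12) :
    (Real.log (Real.log y) - Real.log (Real.log v)) / 6 ≤
        ∑ p ∈ (Ioc ⌊v⌋₊ ⌊y⌋₊).filter
          (fun p => p.Prime ∧ polyRootCountMod ![X ^ 2 - C (-((d₁ * n : ℕ) : ℤ))] p = 2), (1 : ℝ) / p ∨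
      (Real.log (Real.log y) - Real.log (Real.log v)) / 6 ≤
        ∑ p ∈ (Ioc ⌊v⌋₊ ⌊y⌋₊).filter
          (fun p => p.Prime ∧ polyRootCountMod ![X ^ 2 - C (-((d₂ * n : ℕ) : ℤ))] p = 2), (1 : ℝ) / p := by
  by_contra h
  rw [not_or, not_le, not_le] at h
  have hle := sum_filter_omega_mul_le (d₁ := d₁) (d₂ := d₂) (y := y) hn (show (0 : ℝ) < v by linarith)
  have hlow := (abs_le.1 hB).1
  linarith

/-! ### Theorem 9.1 -/

/-- **Lenstra–Pomerance, Theorem 9.1 (choice of the multiplier).** There are absolute constants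
`X₀, K` such that for every odd `n` and reals `z, w ≥ X₀`, `2 ≤ v ≤ y` with
`ω(n) ≤ z/(12 log z)`, `ω(n) ≤ w/(12 log w)`, `K/log v ≤ ℓ/12` and `ω(n)/v ≤ ℓ/12`
(`ω(n) = #primeFactors n`, `ℓ = log log y − log log v`), some `d` in the multiplier set
(`{3,4,7,8}` if `n ≡ 1 (mod 4)`, else `{1,5,8,12}`) makes `Δ = −dn` a negative discriminant
(`Δ < 0`, `Δ ≡ 0, 1 (mod 4)`) with `π(z; 𝒫_Δ) ≥ z/(6 log z)`, `π(w; 𝒫_Δ) ≥ w/(6 log w)` and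
`S(v, y; 𝒫_Δ) ≥ ℓ/6`, where `𝒫_Δ = {p : ω_Δ(p) = 2}` is the set of odd primes `p ∤ Δ` with
`(Δ/p) = 1`, `π(x; 𝒫) = #{p ≤ x : p ∈ 𝒫}` and `S(v, y; 𝒫) = ∑_{v < p ≤ y, p ∈ 𝒫} 1/p` — the
conditions (9.3), (9.4), (9.5) of the paper (with `ℓ` for its `1/log u`, and the `ω(n)`-hypotheses
for its (9.2)). [cite: LenstraPomerance1992, §9 Thm 9.1] -/
theorem exists_multiplier :
    ∃ X₀ K : ℝ, 0 ≤ K ∧ ∀ n : ℕ, Odd n → ∀ z w v y : ℝ, X₀ ≤ z → X₀ ≤ w → 2 ≤ v → v ≤ y →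
      (n.primeFactors.card : ℝ) ≤ z / (12 * Real.log z) →
      (n.primeFactors.card : ℝ) ≤ w / (12 * Real.log w) →
      K / Real.log v ≤ (Real.log (Real.log y) - Real.log (Real.log v)) / 12 →
      (n.primeFactors.card : ℝ) / v ≤ (Real.log (Real.log y) - Real.log (Real.log v)) / 12 →
      ∃ d ∈ (if n % 4 = 1 then ({3, 4, 7, 8} : Finset ℕ) else {1, 5, 8, 12}),
        -((d * n : ℕ) : ℤ) < 0 ∧ ((-((d * n : ℕ) : ℤ)) % 4 = 0 ∨ (-((d * n : ℕ) : ℤ)) % 4 = 1) ∧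
        z / (6 * Real.log z) ≤ #((Nat.primesLE ⌊z⌋₊).filter fun p =>
          polyRootCountMod ![X ^ 2 - C (-((d * n : ℕ) : ℤ))] p = 2) ∧
        w / (6 * Real.log w) ≤ #((Nat.primesLE ⌊w⌋₊).filter fun p =>
          polyRootCountMod ![X ^ 2 - C (-((d * n : ℕ) : ℤ))] p = 2) ∧
        (Real.log (Real.log y) - Real.log (Real.log v)) / 6 ≤
          ∑ p ∈ (Ioc ⌊v⌋₊ ⌊y⌋₊).filter
            (fun p => p.Prime ∧ polyRootCountMod ![X ^ 2 - C (-((d * n : ℕ) : ℤ))] p = 2), (1 : ℝ) / p := by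
  obtain ⟨X₀, K, hX₀2, hK0, hconst⟩ := exists_constants
  refine ⟨X₀, K, hK0, fun n hn z w v y hz hw hv hvy hωz hωw hKv hωv => ?_⟩
  have hn0 : n ≠ 0 := by rintro rfl; exact Nat.not_odd_zero hn
  set 𝒟 := (if n % 4 = 1 then ({3, 4, 7, 8} : Finset ℕ) else {1, 5, 8, 12}) with h𝒟
  have hprod : ∀ a ∈ 𝒟, ∀ b ∈ 𝒟, a ≠ b →
      ((a * b : ℕ) : ℤ) ∈ ({5, 8, 12, 21, 24, 28, 32, 40, 56, 60, 96} : Finset ℤ) :=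
    fun a ha b hb hab => mul_mem_products ha hb hab
  obtain ⟨d, hd, h1, h2, h3⟩ := exists_good_of_pairwise (card_multiplierSet n)
    (fun d => z / (6 * Real.log z) ≤ #((Nat.primesLE ⌊z⌋₊).filter fun p =>
      polyRootCountMod ![X ^ 2 - C (-((d * n : ℕ) : ℤ))] p = 2))
    (fun d => w / (6 * Real.log w) ≤ #((Nat.primesLE ⌊w⌋₊).filter fun p =>
      polyRootCountMod ![X ^ 2 - C (-((d * n : ℕ) : ℤ))] p = 2))
    (fun d => (Real.log (Real.log y) - Real.log (Real.log v)) / 6 ≤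
      ∑ p ∈ (Ioc ⌊v⌋₊ ⌊y⌋₊).filter
        (fun p => p.Prime ∧ polyRootCountMod ![X ^ 2 - C (-((d * n : ℕ) : ℤ))] p = 2), (1 : ℝ) / p)
    (fun a ha b hb hab => count_or_count hn0 ((hconst _ (hprod a ha b hb hab)).1 z hz) hz hωz)
    (fun a ha b hb hab => count_or_count hn0 ((hconst _ (hprod a ha b hb hab)).1 w hw) hw hωw)
    (fun a ha b hb hab => sum_or_sum hn0 hv ((hconst _ (hprod a ha b hb hab)).2 v y hv hvy) hKv hωv)
  obtain ⟨hneg, hdisc⟩ := neg_mul_isNegDiscriminant hn hd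
  exact ⟨d, hd, hneg, hdisc, h1, h2, h3⟩

end LenstraPomerance1992

end Literature.Computability.QuantumComplexity

end
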